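import Literature.AnabelianGeometry.EtaleTheta.SettingModel2Inversion
import Literature.AnabelianGeometry.EtaleTheta.SettingModelPowHat
import Literature.AnabelianGeometry.EtaleTheta.SettingModel2Theta
import Literature.AnabelianGeometry.EtaleTheta.SettingModelChiTwistInversion
import Literature.AnabelianGeometry.EtaleTheta.ZHatLevelDetermination
import Literature.AnabelianGeometry.EtaleTheta.CyclotomeZHatAction
import Literature.AnabelianGeometry.AbsoluteAnabelian.ZHatCompletionAdicCompleteness
import Literature.AnabelianGeometry.AbsoluteAnabelian.ZHatCompletionFreeProcyclic
import Mathlib.Topology.Baire.Lemmas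
import Mathlib.Topology.Baire.LocallyCompactRegular
import HarnessLib

/-!
# An element `A ∈ F̂₂` with `ĥ_l(A) = 1`, `σ̂ A = A⁻¹` and `ê(A) ∉ ι(ℤ)` — the exotic datum of the stage-2 Tate model
# (proof-only companion of `ThetaSettingModelTateProfiniteInnerAut`)

[EtTh] §1 p. 12 (`Π^tp_X ⊆ Π_X`, `ê : F̂₂ → Ẑ`), §2 p. 36 (`σ̂`) [cite: MochizukiEtTh2009, §1 p.12]; Ribes–Zalesskii,
*Profinite groups*, Thm. 2.7.1 (`Ẑ`) [cite: RibesZalesskii2010, Thm 2.7.1].  Cell `abc-iut`, seat abc-iut-L6-d2 (gen 9), K-L6 row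
«HUNIQ-REFUTED-AT-MODEL».  PROOF-ONLY (no definition, no instance, no named fact):
* `exists_pow_not_mem_range_iotaZ` — `∃ v ∈ Ẑ` with `v^l ∉ ι(ℤ)` (`l ≠ 0`): Baire category in the compact Hausdorff group `Ẑ`
  plus the density of `ι(ℤ)` and the injectivity of `ι`;
* `powHat_inv` — `(x⁻¹)^t = (x^t)⁻¹` in `F̂₂`;
* `exoticDatum_props` / `exists_exoticDatum` — `A := (η a^l)^v` has `ĥ_l(A) = 1`, `σ̂ A = A⁻¹`, `ê(A) = v^l ∉ ι(ℤ)`.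
HONEST FRAMING: pure profinite group theory about OUR semi-synthetic model's coordinates; no side taken on [IUTchIII] Cor. 3.12;
nothing asserts abc proved or refuted.
-/

set_option autoImplicit false

noncomputable section

namespace Literature.AnabelianGeometry.EtaleTheta.SettingModel

open Literature.AnabelianGeometry.AbsoluteAnabelian (ZHatCompletion.mul_comm)
open Function
open _root_.Topology

/-! ## §0. `Ẑ` has elements `v` with `v^l ∉ ι(ℤ)` -/

/-- **`∃ v ∈ Ẑ` with `v^l ∉ ι(ℤ)`** (`l ≠ 0`).  Baire category: if every `v^l` were in `ι(ℤ)`, the compact Hausdorff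
group `Ẑ` would be a countable union of the closed fibres `{v | v^l = ι k}`, one of which would then have non-empty
interior; translating, the `l`-torsion subgroup `{v | v^l = 1}` would be OPEN, so (density of `ι(ℤ)`) would contain some
`ι m`, `m ≠ 0` — but `ι(m)^l = ι(l·m) ≠ 1` (`ι` injective). [cite: RibesZalesskii2010, Thm 2.7.1] -/
theorem exists_pow_not_mem_range_iotaZ (l : ℕ) (hl : l ≠ 0) :
    ∃ v : ZH, ∀ k : Multiplicative ℤ, v ^ l ≠ iotaZ k := by
  classical
  haveI : Countable (Multiplicative ℤ) := Countable.of_equiv ℤ Multiplicative.ofAdd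
  by_contra h
  push Not at h
  -- the closed fibres cover `Ẑ`
  let F : Multiplicative ℤ → Set ZH := fun k => {v | v ^ l = iotaZ k}
  have hF : ∀ k, IsClosed (F k) := fun k => isClosed_eq (continuous_pow l) continuous_const
  have hcov : ⋃ k, F k = Set.univ := by
    ext v
    simp only [Set.mem_iUnion, Set.mem_setOf_eq, Set.mem_univ, iff_true, F]
    exact h v
  obtain ⟨k₀, hk₀⟩ := nonempty_interior_of_iUnion_of_closed hF hcov
  obtain ⟨v₀, hv₀⟩ := hk₀
  have hv₀F : v₀ ∈ F k₀ := interior_subset hv₀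
  have hv₀F' : v₀ ^ l = iotaZ k₀ := hv₀F
  -- the torsion subgroup `T := {v | v^l = 1}` contains the open neighbourhood `v₀⁻¹ • interior (F k₀)` of `1`
  let U : Set ZH := (fun v => v₀⁻¹ * v) '' interior (F k₀)
  have hUo : IsOpen U := (Homeomorph.mulLeft v₀⁻¹).isOpenMap _ isOpen_interior
  have hU1 : (1 : ZH) ∈ U := ⟨v₀, hv₀, by simp⟩
  have hUT : ∀ v ∈ U, v ^ l = 1 := by
    rintro _ ⟨w, hw, rfl⟩
    have hwF : w ∈ F k₀ := interior_subset hw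
    have hwF' : w ^ l = iotaZ k₀ := hwF
    show (v₀⁻¹ * w) ^ l = 1
    rw [(show Commute v₀⁻¹ w from ZHatCompletion.mul_comm _ _).mul_pow, inv_pow, hwF', hv₀F', inv_mul_cancel]
  -- either `U` has a point other than `1` — then density of `ι(ℤ)` puts some `ι k ≠ 1` of `l`-torsion in it,
  -- contradicting the injectivity of `ι` — or `U = {1}` is open, so `Ẑ` is discrete, compact, finite: absurd.
  by_cases hU : (U \ {1}).Nonempty
  · have hUo' : IsOpen (U \ {1}) := hUo.sdiff isClosed_singleton
    obtain ⟨k, hk⟩ := denseRange_iotaZ.exists_mem_open hUo' hU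
    have hk1 : iotaZ k ≠ 1 := hk.2
    have hkl : (iotaZ k) ^ l = 1 := hUT _ hk.1
    have hkl' : k ^ l = 1 := iotaZ_injective (by rw [map_pow, hkl, map_one])
    have h0 : Multiplicative.toAdd k = 0 := by
      have h2 := congrArg Multiplicative.toAdd hkl'
      rw [toAdd_pow, toAdd_one, nsmul_eq_mul] at h2
      rcases mul_eq_zero.mp h2 with h3 | h3
      · exact absurd (by exact_mod_cast h3) hl
      · exact h3
    have hk : k = 1 := by rw [← ofAdd_toAdd k, h0, ofAdd_zero]
    exact hk1 (by rw [hk, map_one])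
  · rw [Set.not_nonempty_iff_eq_empty, Set.sdiff_eq_empty] at hU
    have h1 : U = {1} := Set.Subset.antisymm hU (Set.singleton_subset_iff.2 hU1)
    have hopen1 : IsOpen ({1} : Set ZH) := h1 ▸ hUo
    have hdisc : DiscreteTopology ZH := by
      rw [discreteTopology_iff_forall_isOpen]
      intro s
      have hs : s = ⋃ v ∈ s, {v} := (Set.biUnion_of_singleton s).symm
      rw [hs]
      refine isOpen_biUnion fun v _ => ?_
      have := (Homeomorph.mulLeft v).isOpenMap _ hopen1
      simpa using this
    haveI : Finite ZH := finite_of_compact_of_discrete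
    have hinf : (Set.range (iotaZ : Multiplicative ℤ → ZH)).Infinite :=
      Set.infinite_range_of_injective iotaZ_injective
    exact hinf (Set.toFinite _)

/-! ## §3. The exotic datum `A := (a^l)^v` with `ê(A) = v^l ∉ ι(ℤ)` -/

/-- `(x^·)⁻¹ = (x⁻¹)^·`: `powHat x⁻¹ t = (powHat x t)⁻¹` (both are continuous homomorphisms `Ẑ → F̂₂` — the values of
`powHat x` commute — agreeing at `ι 1`). [cite: MochizukiEtTh2009, §1 p.12] -/
theorem powHat_inv (x : F₂hatT) (t : ZH) : powHat x⁻¹ t = (powHat x t)⁻¹ := by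
  have hc : ∀ s t : ZH, Commute (powHat x s) (powHat x t) := fun s t => by
    rw [Commute, SemiconjBy, ← map_mul, ← map_mul, ZHatCompletion.mul_comm]
  let f : ZH →ₜ* F₂hatT :=
    { toFun := fun t => (powHat x t)⁻¹
      map_one' := by rw [map_one, inv_one]
      map_mul' := fun s t => by rw [map_mul, mul_inv_rev, (hc s t).inv_inv.eq]
      continuous_toFun := (powHat x).continuous.inv }
  have hf : f = powHat x⁻¹ := powHat_unique x⁻¹ f (by
    change (powHat x (iotaZ (Multiplicative.ofAdd 1)))⁻¹ = x⁻¹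
    rw [powHat_iotaZ_one])
  exact (DFunLike.congr_fun hf t).symm

/-- **The exotic datum**: for every `l` and every `v ∈ Ẑ` with `v^l ∉ ι(ℤ)`, `A := (η(a^l))^v ∈ F̂₂` has `ĥ_l(A) = 1` (so `Ad(A)`
stabilises `Π^tp_{X̲̲}`), `σ̂ A = A⁻¹` (so `ι ∘ Ad(A)` is an involution), and `ê(A) = v^l ∉ ι(ℤ)` (so `Ad(A)` is outer).
[cite: MochizukiEtTh2009, §1 p.12] -/
theorem exoticDatum_props (l : ℕ+) (v : ZH) (hv : ∀ k : Multiplicative ℤ, v ^ (l : ℕ) ≠ iotaZ k) :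
    hHat l (powHat (eta (FreeGroup.of 0 ^ (l : ℕ))) v) = 1 ∧
    sigmaHat (powHat (eta (FreeGroup.of 0 ^ (l : ℕ))) v) = (powHat (eta (FreeGroup.of 0 ^ (l : ℕ))) v)⁻¹ ∧
    ∀ k : Multiplicative ℤ, eHat (powHat (eta (FreeGroup.of 0 ^ (l : ℕ))) v) ≠ iotaZ k := by
  have hpow : ∀ {R : Type} [CommRing R] (n : ℕ), ((⟨1, 0, 0⟩ : Heis R) ^ n) = ⟨(n : R), 0, 0⟩ := by
    intro R _ n
    induction n with
    | zero => ext <;> simp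
    | succ n ih => rw [pow_succ, ih]; ext <;> simp
  set x : F₂hatT := eta (FreeGroup.of 0 ^ (l : ℕ)) with hxdef
  refine ⟨?_, ?_, ?_⟩
  · -- `ĥ_l ∘ x^·` is the trivial homomorphism: continuous, and trivial at `ι 1` since `ĥ_l(η(a^l)) = (l, 0, 0) = 1`
    have hx1 : hHat l x = 1 := by
      rw [hxdef, hHat_eta, map_pow, heisHom_of_zero, hpow]
      ext <;> simp
    have key := Literature.AnabelianGeometry.AbsoluteAnabelian.ZHatCompletion.monoidHom_ext_of_continuous
      (f₁ := (hHat l).toMonoidHom.comp (powHat x).toMonoidHom) (f₂ := 1)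
      ((hHat l).continuous.comp (powHat x).continuous) continuous_const (by
        change hHat l (powHat x (iotaZ (Multiplicative.ofAdd 1))) = 1
        rw [powHat_iotaZ_one, hx1])
    exact DFunLike.congr_fun key v
  · -- `σ̂ (x^v) = (σ̂ x)^v = (x⁻¹)^v = (x^v)⁻¹`
    have hσx : sigmaHat x = x⁻¹ := by
      rw [hxdef, sigmaHat_eta, map_pow, map_pow, invGenHom_of, map_inv, inv_pow, map_pow]
    rw [map_powHat, hσx, powHat_inv]
  · -- `ê(x^v) = v^l` at every level
    intro k hk
    apply hv k
    rw [← hk]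
    refine ZHatLevel.ext_of_level fun N => ?_
    apply Multiplicative.toAdd.injective
    rw [toAdd_level_eHat_powHat, map_pow, toAdd_pow, nsmul_eq_mul, hxdef, eHat_eta, expA_apply, map_pow,
      heisHom_of_zero, hpow]
    show ((l : ℕ) : ZMod N) * Multiplicative.toAdd (ZHatLevel.level N v) =
      Multiplicative.toAdd (ZHatLevel.level N (ZHatLevel.eta ((l : ℕ) : ℤ))) * Multiplicative.toAdd (ZHatLevel.level N v)
    rw [ZHatLevel.level_eta, toAdd_ofAdd, Int.cast_natCast]

/-- **∃ an exotic datum** `A ∈ F̂₂` for every `l`: `ĥ_l(A) = 1`, `σ̂ A = A⁻¹`, `ê(A) ∉ ι(ℤ)`.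
[cite: MochizukiEtTh2009, §1 p.12] -/
theorem exists_exoticDatum (l : ℕ+) :
    ∃ A : F₂hatT, hHat l A = 1 ∧ sigmaHat A = A⁻¹ ∧ ∀ k : Multiplicative ℤ, eHat A ≠ iotaZ k := by
  obtain ⟨v, hv⟩ := exists_pow_not_mem_range_iotaZ (l : ℕ) (PNat.ne_zero l)
  exact ⟨_, exoticDatum_props l v hv⟩

end Literature.AnabelianGeometry.EtaleTheta.SettingModel

end
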